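import Mathlib
import Summits.ValiantsHypothesis.ValiantsHypothesis.Theorems.KPlusLogSqLawFoldCriterion

/-!
# Route «KPlusLogSqLaw», crux `WeakLifting` (stmt-ValiantsHypothesis-19561) — door (A′), pattern 𝒫: THEOREM 7⁺ assembled for the concrete block factor
# U = x(1 + a x)R²  (cell note THEORY-NOTE-g16 v3 §6e; kernel, g16; companion of `KPlusLogSqLawFoldCriterion.lean` p615193 and `KPlusLogSqLawTwoPointIdentity.lean` p612583)

HONEST FRAMING.  Helper lemmas (`--supports stmt-ValiantsHypothesis-19561 --as helper`), seat pub-symmetroid-conjb-2 (g16), 2026-08-28.  Elementary calculus; no root count is bounded here and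
nothing bears on `WeakLifting` / `TropicalB`, Conjecture B, `MatrixDescartes` or VP ≠ VNP.  (A′) `HalfTurnStripRowTwo` itself is REFUTED at m = 8 (cell deposit g16/negative/); this file is the
m-independent positive statement for P-blocks of log-slope > −2.

CONTENT.  `hasDerivAt_blockU`: derivative of U(y) = y(1 + a y)R(y)².  `blockU_logSlope`: for x > 0, a ≥ 0, R x > 0 the log-slope is x U′/U = 1 + a x/(1 + a x) + 2·(x R′/R x) — the
identification Δ = 1 + s_c + 2 s_R of the paper.  `vcount_deriv_ge_of_block` (THEOREM 7⁺, analytic core, kernel): if moreover V ≥ 0 and the block ratio has log-slope s_R = x R′/R x > −2, the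
V-count G(y) = y + a y² U/(U + V) has derivative ≥ 31/32 at x — assembled from `FoldCriterion.hasDerivAt_vcount`, `FoldCriterion.vcount_deriv_ge`, `FoldCriterion.theta_mem_unitInterval`.
What remains paper-only: s_R > −2 for P-blocks of length ≤ 2 in the concrete continued fraction (the pieces `hasDerivAt_ratio_step`, `slope_two_letters` are in the companion file) and
G′ > 0 ⇒ W ≤ 0 (Prop. 2, argument principle).  [this seat; elementary]
-/

set_option linter.dupNamespace false

namespace Summit.ValiantsHypothesis.ValiantsHypothesis.Theorems.KPlusLogSqLaw.FoldCriterion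

/-- Derivative of the block factor `U(y) = y (1 + a y) R(y)²`. -/
theorem hasDerivAt_blockU (a x R' : ℝ) (R : ℝ → ℝ) (hR : HasDerivAt R R' x) :
    HasDerivAt (fun y => y * (1 + a * y) * R y ^ 2)
      ((1 + 2 * a * x) * R x ^ 2 + x * (1 + a * x) * (2 * R x * R')) x := by
  have h1 : HasDerivAt (fun y : ℝ => y * (1 + a * y)) (1 + 2 * a * x) x := by
    have hid : HasDerivAt (fun y : ℝ => y) 1 x := hasDerivAt_id' x
    have hlin : HasDerivAt (fun y : ℝ => 1 + a * y) a x := by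
      simpa using (hid.const_mul a).const_add 1
    exact (hid.mul hlin).congr_deriv (by ring)
  have h2 : HasDerivAt (fun y => R y ^ 2) (2 * R x * R') x :=
    (hR.pow 2).congr_deriv (by norm_num : ((2 : ℕ) : ℝ) * R x ^ (2 - 1) * R' = 2 * R x * R')
  exact h1.mul h2

/-- The log-slope of the block factor: `x U′/U = 1 + s_c + 2 s_R` with `s_c = a x/(1 + a x)`, `s_R = x R′/R`. -/
theorem blockU_logSlope (a x R' Rx : ℝ) (hx : 0 < x) (ha : 0 ≤ a) (hRx : 0 < Rx) :
    x * ((1 + 2 * a * x) * Rx ^ 2 + x * (1 + a * x) * (2 * Rx * R')) / (x * (1 + a * x) * Rx ^ 2)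
      = 1 + a * x / (1 + a * x) + 2 * (x * R' / Rx) := by
  have h1 : 0 < 1 + a * x := by positivity
  field_simp
  ring

/-- THEOREM 7⁺ (analytic core, assembled).  For the V-count `G(y) = y + a y² U(y)/(U(y) + V)` with the concrete block factor `U(y) = y(1 + a y)R(y)²`:
if `x > 0`, `a ≥ 0`, `V ≥ 0`, `R x > 0` and the block ratio has log-slope `x R′/R x > −2` at `x`, then `G` has a derivative `≥ 31/32` at `x`
(in particular the wall curve has no fold there). -/
theorem vcount_deriv_ge_of_block (a V x R' : ℝ) (R : ℝ → ℝ) (hR : HasDerivAt R R' x) (hx : 0 < x) (ha : 0 ≤ a) (hV : 0 ≤ V)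
    (hRx : 0 < R x) (hs : -2 < x * R' / R x) :
    ∃ G' : ℝ, HasDerivAt (fun y => y + a * y ^ 2 * (y * (1 + a * y) * R y ^ 2) / (y * (1 + a * y) * R y ^ 2 + V)) G' x ∧ (31 / 32 : ℝ) ≤ G' := by
  set U : ℝ → ℝ := fun y => y * (1 + a * y) * R y ^ 2 with hUdef
  have hU : HasDerivAt U ((1 + 2 * a * x) * R x ^ 2 + x * (1 + a * x) * (2 * R x * R')) x := hasDerivAt_blockU a x R' R hR
  have hUx : 0 < U x := by
    have h1 : 0 < 1 + a * x := by positivity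
    show 0 < x * (1 + a * x) * R x ^ 2
    positivity
  have hG := hasDerivAt_vcount a V x _ U hU hUx hV
  refine ⟨_, hG, ?_⟩
  -- rewrite the log-slope and apply the abstract bound with A = a x, θ = U/(U+V), s = s_R
  have hslope : x * ((1 + 2 * a * x) * R x ^ 2 + x * (1 + a * x) * (2 * R x * R')) / U x
      = 1 + a * x / (1 + a * x) + 2 * (x * R' / R x) := blockU_logSlope a x R' (R x) hx ha hRx
  rw [hslope]
  have hθ := theta_mem_unitInterval (U x) V hUx hV
  have hA : 0 ≤ a * x := by positivity
  have key := vcount_deriv_ge (a * x) (U x / (U x + V)) (x * R' / R x) hA hθ.1 hθ.2 hs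
  -- match the two shapes: a * x * θ * (…) with A/(1+A) = a x/(1 + a x)
  have e : 1 + a * x * (U x / (U x + V)) * (2 + (1 + a * x / (1 + a * x) + 2 * (x * R' / R x)) * (1 - U x / (U x + V)))
      = 1 + a * x * (U x / (U x + V)) * (2 + (1 + a * x / (1 + a * x) + 2 * (x * R' / R x)) * (1 - U x / (U x + V))) := rfl
  linarith [key]

end Summit.ValiantsHypothesis.ValiantsHypothesis.Theorems.KPlusLogSqLaw.FoldCriterion
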